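import Literature.Computability.Cryptography.BLPRSRejParamsAny
import Literature.Computability.Complexity.MachinPiFP
import Literature.Algebra.EuclideanLattices.RegevUSVPInstance
import Literature.Algebra.EuclideanLattices.UniqueSVPBasisVector
import Literature.Algebra.EuclideanLattices.SuccessiveMinimaProofs
import HarnessLib

/-!
# Regev's bootstrap sampler (Lemma 3.2): the width parameter and a sampler accuracy uniform in the width

Topic `Computability/Cryptography` (LWE), grouping namespaces `BLPRS2013` (the GPV rejection sampler of
`BLPRSRejParamsAny.lean`) and `Regev2009` (the bootstrap step of [Regev2009, Lemma 3.2]).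

Regev's classical bootstrap sampler for `D_{L,r}` with `r > 2^{2n} λₙ(L)` (Lemma 3.2, proof on p. 15 of
arXiv:2401.03703) draws `n` one-dimensional discrete Gaussians `D_{ℤ,s}` (the coefficient law of the
continuous `ν_s` after Babai round-off is replaced here by the genuinely discrete product law of
`RegevBootstrapDiscrete.lean`) and rounds off against an LLL-reduced basis.  The machine of
`RegevReductionLemma32Sampler.lean` realises `D_{ℤ,s}` by the GPV rejection sampler at the rational
`θ = n/A²` (`√(π/θ) = A√(π/n)`), where the integer `A` must make `A√(π/n)` lie in `[r, r(1 + 2·2⁻ⁿ)]`.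
This file supplies the two analytic inputs, everything PROVED:

* `BLPRS2013.tvDist_rejLaw_wide_le`: for `n ≥ 16`, `n ≤ A²`, the sampler's output is
  `113(⌊√n⌋+1)·2⁻ⁿ`-close to `D_{ℤ,A√(π/n),c'}` — a bound UNIFORM in `A` (the bound
  `(7 + 50A)·2⁻ⁿ` of `tvDist_rejLaw_any_le` is useless here since `A ≈ r√n` is unbounded at fixed `n`;
  the gain comes from `1/Z ≤ 1/G_W ≤ e/(m+1) ≤ 6(⌊√n⌋+1)/A`);
* `Regev2009.piLower p = piApprox p − 2⁻ᵖ/2 ∈ [π − 2⁻ᵖ, π]` (a rational lower bound of `π` from the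
  Machin sums of `MachinPiFP.lean`), `Regev2009.bootA ρ n = ⌊√(round(ρ²n/π₋ₙ))⌋ + 2` and its bracketing
  `ρ ≤ bootA ρ n · √(π/n) ≤ ρ(1 + 2·2⁻ⁿ)` for `ρ ≥ 2^{2n}`, `n ≥ 16` (`rho_le_bootWidth`, `bootWidth_le`),
  `n ≤ (bootA ρ n)²` for `ρ ≥ 2` (`le_bootA_sq`), `sqrt_pi_div_thetaA`;
* `Regev2009.one_le_successiveMinimum_n`: `1 ≤ λₙ(L(B))` for a nonsingular integer basis.

## References
* O. Regev, *On lattices, learning with errors, random linear codes, and cryptography*, J. ACM 56(6),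
  2009; arXiv:2401.03703, Lemma 3.2 (p. 15), Claim 2.13. [Regev2009]
* C. Gentry, C. Peikert, V. Vaikuntanathan, *Trapdoors for hard lattices and new cryptographic
  constructions*, STOC 2008, Lemma 4.2. [GentryPeikertVaikuntanathan2008]
* Z. Brakerski, A. Langlois, C. Peikert, O. Regev, D. Stehlé, *Classical hardness of learning with
  errors*, STOC 2013; arXiv:1306.0281, §5. [BrakerskiEtAl2013]
* J. M. Borwein, P. B. Borwein, *Pi and the AGM*, Wiley 1987, §11.1. [BorweinBorwein1987]
-/

noncomputable section

open Filter Module Literature.Algebra.EuclideanLattices Literature.Probability.Distributions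
open Literature.Computability.Complexity Literature.Computability.Complexity.MachinPi
open scoped Real

namespace Literature.Computability.Cryptography

namespace BLPRS2013

/-! ### The rejection sampler at `θ = n/A²` is accurate uniformly in `A` -/

/-- **The GPV rejection sampler at `θ = n/A²` is `113(⌊√n⌋+1)·2⁻ⁿ`-close to `D_{ℤ,√(π/θ),c'}`** for
`n ≥ 16` and `n ≤ A²`, uniformly in `A` and in the centre: the three terms of
`GaussRej.tvDist_rejLaw_discreteGaussianInt_le` are bounded using `1/Z ≤ 1/G_W ≤ e/(m+1)` and
`m + 1 ≥ A/(2(⌊√n⌋+1))`. [cite: GentryPeikertVaikuntanathan2008, Lemma 4.2; BrakerskiEtAl2013, §5] -/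
theorem tvDist_rejLaw_wide_le {A n : ℕ} (hApos : 0 < A) (hAn : n ≤ A ^ 2) (hn : 16 ≤ n) (c' : ℚ) :
    (GaussRej.rejLaw (thetaA A n) c' (rejS n) (rejN n) (rejP n) (wA A) (rejR n)).tvDist
        (discreteGaussianInt (Real.sqrt (π / (thetaA A n : ℝ))) c') ≤
      113 * ((Nat.sqrt n : ℝ) + 1) / (2 : ℝ) ^ n := by
  have hn0 : 0 < n := by omega
  have hθ := thetaA_pos hApos hn0
  have hθ1 := thetaA_le_one hApos hAn
  -- elementary facts on `A`, `n`, `m`, `w`, `θ` (small context first)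
  have hA : (0 : ℝ) < A := by exact_mod_cast hApos
  have hA0 : (A : ℝ) ≠ 0 := hA.ne'
  have hA1 : (1 : ℝ) ≤ A := by exact_mod_cast hApos
  obtain ⟨hw1, hw2⟩ := window_boundsA hApos
  have hw1' : 2 * (A : ℝ) < (2 : ℝ) ^ wA A := by exact_mod_cast hw1
  have hw2' : ((2 : ℝ) ^ wA A) ≤ 4 * A := by exact_mod_cast hw2
  have hw8 : (2 : ℝ) ^ (wA A + 1) ≤ 8 * A := by rw [pow_succ]; linarith only [hw2']
  have he1 : Real.exp 1 ≤ 3 := le_of_lt (lt_trans Real.exp_one_lt_d9 (by norm_num))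
  have he : Real.exp (-1) * Real.exp 1 = 1 := by rw [← Real.exp_add]; norm_num
  have hm1 : (A : ℝ) / (2 * ((Nat.sqrt n : ℝ) + 1)) ≤ (mA A n : ℝ) + 1 := rejM_add_one_geA A n
  have hsq1 : (0 : ℝ) < (Nat.sqrt n : ℝ) + 1 := by positivity
  have hs1 : (1 : ℝ) ≤ (Nat.sqrt n : ℝ) + 1 := by
    have := Nat.cast_nonneg (α := ℝ) (Nat.sqrt n); linarith only [this]
  have hm0 : (0 : ℝ) < (mA A n : ℝ) + 1 := by positivity
  have h2n : (0 : ℝ) < (2 : ℝ) ^ n := by positivity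
  have h2w : (0 : ℝ) < 2 ^ (wA A + 1) := by positivity
  have hm1inv : 1 / ((mA A n : ℝ) + 1) ≤ 2 * ((Nat.sqrt n : ℝ) + 1) / A := by
    rw [div_le_div_iff₀ hm0 hA, one_mul]
    have := mul_le_mul_of_nonneg_right hm1 (show (0 : ℝ) ≤ 2 * ((Nat.sqrt n : ℝ) + 1) by positivity)
    rw [div_mul_cancel₀ _ (by positivity)] at this
    linarith only [this]
  have hθeq : ((thetaA A n : ℚ) : ℝ) = (n : ℝ) / (A : ℝ) ^ 2 := cast_thetaA A n
  have hθ0 : (0 : ℝ) < (thetaA A n : ℝ) := by exact_mod_cast hθ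
  have hx : 3 / 2 * (A : ℝ) ≤ (2 : ℝ) ^ wA A - 1 / 2 := by linarith only [hw1', hA1]
  have hx0 : (0 : ℝ) < (2 : ℝ) ^ wA A - 1 / 2 := lt_of_lt_of_le (by positivity) hx
  have hexp_arg : (n : ℝ) ≤ (thetaA A n : ℝ) * ((2 : ℝ) ^ wA A - 1 / 2) ^ 2 := by
    have h1 : (n : ℝ) ≤ (thetaA A n : ℝ) * (3 / 2 * A) ^ 2 := by
      rw [hθeq, div_mul_eq_mul_div, le_div_iff₀ (by positivity)]
      have hn' : (0 : ℝ) ≤ n := Nat.cast_nonneg _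
      nlinarith [hn', sq_nonneg (A : ℝ)]
    exact h1.trans (mul_le_mul_of_nonneg_left (pow_le_pow_left₀ (by positivity) hx 2) hθ0.le)
  have hinv : 1 / (2 * (thetaA A n : ℝ) * ((2 : ℝ) ^ wA A - 1 / 2)) ≤ (A : ℝ) / 3 := by
    rw [div_le_div_iff₀ (by positivity) (by norm_num), one_mul]
    have h1 : (3 : ℝ) ≤ 2 * (thetaA A n : ℝ) * (3 / 2 * A) * A := by
      rw [hθeq]
      have e : 2 * ((n : ℝ) / (A : ℝ) ^ 2) * (3 / 2 * A) * A = 3 * n := by field_simp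
      rw [e]
      have hn1 : (1 : ℝ) ≤ n := by exact_mod_cast hn0
      linarith only [hn1]
    calc (3 : ℝ) ≤ 2 * (thetaA A n : ℝ) * (3 / 2 * A) * A := h1
      _ ≤ 2 * (thetaA A n : ℝ) * ((2 : ℝ) ^ wA A - 1 / 2) * A := by gcongr
      _ = (A : ℝ) * (2 * (thetaA A n : ℝ) * ((2 : ℝ) ^ wA A - 1 / 2)) := by ring
  have hexp : Real.exp (-((thetaA A n : ℝ) * ((2 : ℝ) ^ wA A - 1 / 2) ^ 2)) ≤ 1 / (2 : ℝ) ^ n :=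
    (Real.exp_le_exp.2 (by linarith only [hexp_arg])).trans (exp_neg_le_inv_two_pow n)
  -- the sampler estimate
  set η₀ : ℝ := (2 : ℝ) ^ (rejS n + 1) / (rejN n).factorial + 1 / 2 ^ rejP n with hη₀
  have hη₀0 : 0 ≤ η₀ := by rw [hη₀]; positivity
  have hηle : η₀ ≤ 2 / (2 : ℝ) ^ n := rejEta_le n
  have hacc : ∀ o : Fin (2 ^ (wA A + 1)),
      |(GaussRej.accNum (thetaA A n) c' (rejS n) (rejN n) (rejP n) (GaussRej.window c' (wA A) o) : ℝ) /
            2 ^ rejP n - GaussRej.gfun (thetaA A n) c' (GaussRej.window c' (wA A) o)| ≤ η₀ :=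
    fun o => GaussRej.abs_accNum_window_sub_le hθ.le c' (rejP n) (wA A) (rejS_specA hApos hn0)
      (by unfold rejN; omega) o
  have hpos := GaussRej.accTot_pos hθ.le hθ1 c' (rejS n) (rejN n) (rejP n) (wA A)
    (rejEta_le_half (by omega)) hacc
  have hmain := GaussRej.tvDist_rejLaw_discreteGaussianInt_le hθ c' (rejS n) (rejN n) (rejP n) (wA A)
    hacc hpos (rejR n)
  refine hmain.trans ?_
  obtain ⟨hP0, hP1⟩ := GaussRej.accProb_mem (thetaA A n) c' (rejS n) (rejN n) (rejP n) (wA A)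
  have hAge := GaussRej.accProb_ge (thetaA A n) c' (rejS n) (rejN n) (rejP n) (wA A) hacc
  have hG := GaussRej.GW_ge hθ.le c' (wA A) (mA A n) (rejM_specA hApos hAn hn0) (rejM_lt_windowA hApos n)
  have hG0 := GaussRej.GW_pos (thetaA A n) c' (wA A)
  have hZG := GaussRej.GW_le_Zr hθ c' (wA A)
  have hZ0 := GaussRej.Zr_pos hθ c'
  have htail := GaussRej.Zr_sub_GW_le hθ c' (wA A)
  set G := GaussRej.GW (thetaA A n) c' (wA A) with hGdef
  set Z := GaussRej.Zr (thetaA A n) c' with hZdef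
  -- `1/G ≤ e/(m+1) ≤ 6(⌊√n⌋+1)/A`
  have hGinv : 1 / G ≤ Real.exp 1 / ((mA A n : ℝ) + 1) := by
    rw [div_le_div_iff₀ hG0 hm0, one_mul]
    calc (mA A n : ℝ) + 1 = ((mA A n : ℝ) + 1) * Real.exp (-1) * Real.exp 1 := by
          rw [mul_assoc, he, mul_one]
      _ ≤ G * Real.exp 1 := mul_le_mul_of_nonneg_right hG (Real.exp_pos 1).le
      _ = Real.exp 1 * G := mul_comm _ _
  have hGinv' : 1 / G ≤ 6 * ((Nat.sqrt n : ℝ) + 1) / A := by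
    calc 1 / G ≤ Real.exp 1 / ((mA A n : ℝ) + 1) := hGinv
      _ = Real.exp 1 * (1 / ((mA A n : ℝ) + 1)) := by ring
      _ ≤ 3 * (2 * ((Nat.sqrt n : ℝ) + 1) / A) := mul_le_mul he1 hm1inv (by positivity) (by norm_num)
      _ = 6 * ((Nat.sqrt n : ℝ) + 1) / A := by ring
  -- term 1
  have h1 : (1 - GaussRej.accProb (thetaA A n) c' (rejS n) (rejN n) (rejP n) (wA A)) ^ rejR n ≤
      1 / (2 : ℝ) ^ n := by
    refine le_trans ?_ (rej_term1A hApos hn)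
    refine pow_le_pow_left₀ (sub_nonneg.2 hP1) ?_ (rejR n)
    have : ((mA A n : ℝ) + 1) * Real.exp (-1) / 2 ^ (wA A + 1) ≤ G / 2 ^ (wA A + 1) :=
      div_le_div_of_nonneg_right hG h2w.le
    linarith only [hAge, this]
  -- term 2
  have h2 : 2 ^ (wA A + 1) * η₀ / G ≤ 96 * ((Nat.sqrt n : ℝ) + 1) / (2 : ℝ) ^ n := by
    calc 2 ^ (wA A + 1) * η₀ / G = 2 ^ (wA A + 1) * η₀ * (1 / G) := by ring
      _ ≤ (8 * A) * (2 / (2 : ℝ) ^ n) * (6 * ((Nat.sqrt n : ℝ) + 1) / A) :=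
          mul_le_mul (mul_le_mul hw8 hηle hη₀0 (by positivity)) hGinv'
            (one_div_pos.2 hG0).le (by positivity)
      _ = 96 * ((Nat.sqrt n : ℝ) + 1) / (2 : ℝ) ^ n := by field_simp; ring
  -- term 3
  have htail' : Z - G ≤ 2 * (1 / (2 : ℝ) ^ n) * (1 + (A : ℝ) / 3) := by
    refine htail.trans ?_
    have hfac : 1 + 1 / (2 * (thetaA A n : ℝ) * ((2 : ℝ) ^ wA A - 1 / 2)) ≤ 1 + (A : ℝ) / 3 := by
      linarith only [hinv]
    have hfac0 : 0 ≤ 1 + 1 / (2 * (thetaA A n : ℝ) * ((2 : ℝ) ^ wA A - 1 / 2)) := by positivity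
    exact mul_le_mul (mul_le_mul_of_nonneg_left hexp (by norm_num)) hfac hfac0 (by positivity)
  have h3 : (Z - G) / Z ≤ 16 * ((Nat.sqrt n : ℝ) + 1) / (2 : ℝ) ^ n := by
    have hd0 : 0 ≤ Z - G := sub_nonneg.2 hZG
    have hZinv : 1 / Z ≤ 1 / G := one_div_le_one_div_of_le hG0 hZG
    have hA' : 1 / (A : ℝ) ≤ 1 := by rw [div_le_one hA]; exact hA1
    calc (Z - G) / Z = (Z - G) * (1 / Z) := by ring
      _ ≤ (2 * (1 / (2 : ℝ) ^ n) * (1 + (A : ℝ) / 3)) * (6 * ((Nat.sqrt n : ℝ) + 1) / A) :=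
          mul_le_mul htail' (hZinv.trans hGinv') (one_div_pos.2 hZ0).le (by positivity)
      _ = 12 * ((Nat.sqrt n : ℝ) + 1) * (1 / A + 1 / 3) / (2 : ℝ) ^ n := by field_simp; ring
      _ ≤ 12 * ((Nat.sqrt n : ℝ) + 1) * (1 + 1 / 3) / (2 : ℝ) ^ n := by gcongr
      _ = 16 * ((Nat.sqrt n : ℝ) + 1) / (2 : ℝ) ^ n := by ring
  have hsum : 1 / (2 : ℝ) ^ n + 96 * ((Nat.sqrt n : ℝ) + 1) / (2 : ℝ) ^ n +
      16 * ((Nat.sqrt n : ℝ) + 1) / (2 : ℝ) ^ n ≤ 113 * ((Nat.sqrt n : ℝ) + 1) / (2 : ℝ) ^ n := by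
    rw [← add_div, ← add_div]
    exact div_le_div_of_nonneg_right (by linarith only [hs1]) h2n.le
  linarith only [h1, h2, h3, hsum]

end BLPRS2013

namespace Regev2009

open BLPRS2013

/-! ### `√(π/θ) = A√(π/n)` and `λₙ ≥ 1` -/

/-- **`√(π/θ) = A·√(π/n)` at `θ = n/A²`.** [cite: GentryPeikertVaikuntanathan2008, §4.1] -/
theorem sqrt_pi_div_thetaA {A n : ℕ} (hA : 0 < A) (hn : 0 < n) :
    Real.sqrt (π / (thetaA A n : ℝ)) = A * Real.sqrt (π / n) := by
  have hA' : (0 : ℝ) < A := by exact_mod_cast hA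
  have hn' : (0 : ℝ) < n := by exact_mod_cast hn
  rw [cast_thetaA, show π / ((n : ℝ) / (A : ℝ) ^ 2) = (A : ℝ) ^ 2 * (π / n) by field_simp,
    Real.sqrt_mul (sq_nonneg _), Real.sqrt_sq hA'.le]

/-- **`λₙ(L(B)) ≥ 1` for a nonsingular integer basis** (`λₙ ≥ λ₁ = λ₁(L) ≥ 1`, integrality).
[cite: MicciancioGoldwasser2002, Ch. 1, §1] -/
theorem one_le_successiveMinimum_n {I : LatticeInstance} (hI : I.IsNonsingular) (hn : 1 ≤ I.n) :
    1 ≤ successiveMinimum I.lattice I.n := by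
  have h1 := Regev2004.one_le_minNorm hI hn
  have h2 : successiveMinimum I.lattice 1 = minNorm I.lattice :=
    successiveMinimum_one_eq_minNorm_holds I.lattice
  have h3 : successiveMinimum I.lattice 1 ≤ successiveMinimum I.lattice I.n :=
    successiveMinimum_mono_holds I.lattice hn
      (by rw [LatticeInstance.span_real_lattice_eq_top hI, finrank_top, finrank_euclideanSpace_fin])
  linarith

/-! ### A rational lower bound of `π` -/

/-- **`π₋ₚ := piApprox p − 2⁻ᵖ/2`**, a rational lower bound of `π` within `2⁻ᵖ`.
[cite: BorweinBorwein1987, §11.1] -/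
def piLower (p : ℕ) : ℚ := piApprox p - 1 / (2 * 2 ^ p)

/-- `π₋ₚ ≤ π`. [cite: BorweinBorwein1987, §11.1] -/
theorem piLower_le_pi (p : ℕ) : (piLower p : ℝ) ≤ π := by
  have h := abs_pi_sub_piApprox_le p
  rw [abs_le] at h
  unfold piLower; push_cast; linarith [h.1, h.2]

/-- `π − 2⁻ᵖ ≤ π₋ₚ`. [cite: BorweinBorwein1987, §11.1] -/
theorem pi_sub_le_piLower (p : ℕ) : π - 1 / (2 : ℝ) ^ p ≤ (piLower p : ℝ) := by
  have h := abs_pi_sub_piApprox_le p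
  rw [abs_le] at h
  have h2 : (0 : ℝ) < 2 ^ p := by positivity
  have e : 1 / (2 * (2 : ℝ) ^ p) = (1 / (2 : ℝ) ^ p) / 2 := by field_simp
  unfold piLower; push_cast; rw [e] at h ⊢; linarith [h.1, h.2]

/-- `2 ≤ π₋ₚ` (from `π > 3`). [cite: BorweinBorwein1987, §11.1] -/
theorem two_le_piLower (p : ℕ) : (2 : ℝ) ≤ (piLower p : ℝ) := by
  have h := pi_sub_le_piLower p
  have h1 : 1 / (2 : ℝ) ^ p ≤ 1 := by
    rw [div_le_one (by positivity)]; exact one_le_pow₀ (by norm_num)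
  linarith [Real.pi_gt_three]

/-- `0 < π₋ₚ`. [cite: BorweinBorwein1987, §11.1] -/
theorem piLower_pos (p : ℕ) : (0 : ℝ) < (piLower p : ℝ) := by linarith [two_le_piLower p]

/-! ### The integer width parameter `A` of the bootstrap sampler -/

/-- **The rational `ρ²n/π₋ₙ`** whose rounded square root gives `A`. [cite: Regev2009, Lemma 3.2 (proof)] -/
def widthSq (ρ : ℚ) (n : ℕ) : ℚ := ρ ^ 2 * n / piLower n

/-- **The integer `A = ⌊√(round(ρ²n/π₋ₙ))⌋ + 2`**: then `θ = n/A²` makes `√(π/θ) = A√(π/n) ∈ [ρ, ρ(1+2·2⁻ⁿ)]`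
(`rho_le_bootWidth`, `bootWidth_le`). [cite: Regev2009, Lemma 3.2 (proof)] -/
def bootA (ρ : ℚ) (n : ℕ) : ℕ := Nat.sqrt (round (widthSq ρ n)).toNat + 2

/-- `2 ≤ A`. [cite: Regev2009, Lemma 3.2 (proof)] -/
theorem two_le_bootA (ρ : ℚ) (n : ℕ) : 2 ≤ bootA ρ n := Nat.le_add_left _ _

/-- `0 < A`. [cite: Regev2009, Lemma 3.2 (proof)] -/
theorem bootA_pos (ρ : ℚ) (n : ℕ) : 0 < bootA ρ n := lt_of_lt_of_le (by norm_num) (two_le_bootA ρ n)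

/-- `0 ≤ ρ²n/π₋ₙ`. [cite: Regev2009, Lemma 3.2 (proof)] -/
theorem widthSq_nonneg (ρ : ℚ) (n : ℕ) : 0 ≤ widthSq ρ n := by
  have h : (0 : ℝ) ≤ (widthSq ρ n : ℝ) := by
    unfold widthSq; push_cast; exact div_nonneg (by positivity) (piLower_pos n).le
  exact_mod_cast h

/-- **Lower bracket of `A²`**: `ρ²n/π₋ₙ + 3 ≤ A²`. [cite: Regev2009, Lemma 3.2 (proof)] -/
theorem widthSq_add_three_le_bootA_sq (ρ : ℚ) (n : ℕ) :
    (widthSq ρ n : ℝ) + 3 ≤ ((bootA ρ n : ℕ) : ℝ) ^ 2 := by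
  set q := widthSq ρ n with hq
  set k : ℕ := (round q).toNat with hk
  have hr : (q : ℝ) - 1 / 2 ≤ ((round q : ℤ) : ℝ) := by
    have h := abs_sub_round q
    rw [abs_le] at h
    have h' : ((q - round q : ℚ) : ℝ) ≤ ((1 / 2 : ℚ) : ℝ) := by exact_mod_cast h.2
    push_cast at h'
    linarith
  have hk' : ((round q : ℤ) : ℝ) ≤ (k : ℝ) := by
    have : (round q : ℤ) ≤ (k : ℤ) := Int.self_le_toNat _
    exact_mod_cast this
  have hsq : k + 1 ≤ (Nat.sqrt k + 1) ^ 2 := Nat.succ_le_of_lt (Nat.lt_succ_sqrt' k)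
  have hsq' : (k : ℝ) + 1 ≤ ((Nat.sqrt k : ℕ) : ℝ) ^ 2 + 2 * (Nat.sqrt k : ℕ) + 1 := by
    have : ((k + 1 : ℕ) : ℝ) ≤ (((Nat.sqrt k + 1) ^ 2 : ℕ) : ℝ) := by exact_mod_cast hsq
    push_cast at this; linarith
  have hA : ((bootA ρ n : ℕ) : ℝ) = (Nat.sqrt k : ℕ) + 2 := by
    unfold bootA; rw [← hq, ← hk]; push_cast; ring
  rw [hA]
  have h0 : (0 : ℝ) ≤ (Nat.sqrt k : ℕ) := Nat.cast_nonneg _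
  nlinarith

/-- **Upper bracket of `A`**: `A ≤ √(ρ²n/π₋ₙ) + 3`. [cite: Regev2009, Lemma 3.2 (proof)] -/
theorem bootA_le_sqrt_widthSq_add_three (ρ : ℚ) (n : ℕ) :
    ((bootA ρ n : ℕ) : ℝ) ≤ Real.sqrt (widthSq ρ n : ℝ) + 3 := by
  set q := widthSq ρ n with hq
  set k : ℕ := (round q).toNat with hk
  have hq0 : (0 : ℝ) ≤ (q : ℝ) := by exact_mod_cast widthSq_nonneg ρ n
  have hr : ((round q : ℤ) : ℝ) ≤ (q : ℝ) + 1 / 2 := by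
    have h := abs_sub_round q
    rw [abs_le] at h
    have h' : ((-(1 / 2) : ℚ) : ℝ) ≤ ((q - round q : ℚ) : ℝ) := by exact_mod_cast h.1
    push_cast at h'
    linarith
  have hr0 : 0 ≤ round q := by
    rw [round_eq]; exact Int.floor_nonneg.2 (by linarith only [widthSq_nonneg ρ n])
  have hk' : (k : ℝ) = ((round q : ℤ) : ℝ) := by
    have : (k : ℤ) = round q := Int.toNat_of_nonneg hr0
    exact_mod_cast this
  have hkq : (k : ℝ) ≤ (q : ℝ) + 1 / 2 := hk' ▸ hr
  have hs : ((Nat.sqrt k : ℕ) : ℝ) ≤ Real.sqrt (k : ℝ) := by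
    rw [Real.le_sqrt (Nat.cast_nonneg _) (Nat.cast_nonneg _)]
    exact_mod_cast Nat.sqrt_le' k
  have hs2 : Real.sqrt (k : ℝ) ≤ Real.sqrt (q : ℝ) + 1 := by
    rw [Real.sqrt_le_left (by positivity)]
    nlinarith [Real.sq_sqrt hq0, Real.sqrt_nonneg (q : ℝ)]
  have hA : ((bootA ρ n : ℕ) : ℝ) = (Nat.sqrt k : ℕ) + 2 := by
    unfold bootA; rw [← hq, ← hk]; push_cast; ring
  rw [hA]; linarith

/-- **`n ≤ A²` once `ρ ≥ 2`** (so that `θ = n/A² ≤ 1`). [cite: Regev2009, Lemma 3.2 (proof)] -/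
theorem le_bootA_sq {ρ : ℚ} (hρ : 2 ≤ ρ) (n : ℕ) : n ≤ bootA ρ n ^ 2 := by
  have h := widthSq_add_three_le_bootA_sq ρ n
  have hπ := piLower_le_pi n
  have hπ0 := piLower_pos n
  have hρ' : (2 : ℝ) ≤ (ρ : ℝ) := by exact_mod_cast hρ
  have hq : (n : ℝ) ≤ (widthSq ρ n : ℝ) := by
    unfold widthSq; push_cast
    rw [le_div_iff₀ hπ0]
    have hn0 : (0 : ℝ) ≤ n := Nat.cast_nonneg _
    have : (piLower n : ℝ) ≤ (ρ : ℝ) ^ 2 := by nlinarith [Real.pi_lt_four]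
    nlinarith
  have : (n : ℝ) ≤ ((bootA ρ n ^ 2 : ℕ) : ℝ) := by push_cast; linarith
  exact_mod_cast this

/-- **Lower bracket of the width**: `ρ ≤ A·√(π/n)` (`ρ ≥ 0`, `n ≥ 1`). [cite: Regev2009, Lemma 3.2 (proof)] -/
theorem rho_le_bootWidth {ρ : ℚ} (hρ : 0 ≤ ρ) {n : ℕ} (hn : 0 < n) :
    (ρ : ℝ) ≤ (bootA ρ n : ℕ) * Real.sqrt (π / n) := by
  have h := widthSq_add_three_le_bootA_sq ρ n
  have hπ := piLower_le_pi n
  have hπ0 := piLower_pos n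
  have hn' : (0 : ℝ) < n := by exact_mod_cast hn
  have hρ' : (0 : ℝ) ≤ (ρ : ℝ) := by exact_mod_cast hρ
  have hA0 : (0 : ℝ) ≤ ((bootA ρ n : ℕ) : ℝ) := Nat.cast_nonneg _
  -- `ρ² ≤ A²·π/n`
  have hq : (ρ : ℝ) ^ 2 * n / π ≤ (widthSq ρ n : ℝ) := by
    unfold widthSq; push_cast
    exact div_le_div_of_nonneg_left (by positivity) hπ0 hπ
  have hsq : (ρ : ℝ) ^ 2 ≤ (((bootA ρ n : ℕ) : ℝ) * Real.sqrt (π / n)) ^ 2 := by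
    rw [mul_pow, Real.sq_sqrt (by positivity)]
    rw [div_le_iff₀ Real.pi_pos] at hq
    rw [mul_div_assoc', le_div_iff₀ hn']
    calc (ρ : ℝ) ^ 2 * n ≤ (widthSq ρ n : ℝ) * π := hq
      _ ≤ ((bootA ρ n : ℕ) : ℝ) ^ 2 * π := mul_le_mul_of_nonneg_right (by linarith only [h]) Real.pi_pos.le
  exact (abs_le_of_sq_le_sq' hsq (by positivity)).2

/-- **Upper bracket of the width**: `A·√(π/n) ≤ ρ(1 + 2·2⁻ⁿ)` for `ρ ≥ 2^{2n}`, `n ≥ 16`.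
[cite: Regev2009, Lemma 3.2 (proof)] -/
theorem bootWidth_le {ρ : ℚ} {n : ℕ} (hn : 16 ≤ n) (hρ : (2 : ℝ) ^ (2 * n) ≤ ρ) :
    (bootA ρ n : ℕ) * Real.sqrt (π / n) ≤ (ρ : ℝ) * (1 + 2 / (2 : ℝ) ^ n) := by
  have hA := bootA_le_sqrt_widthSq_add_three ρ n
  have hπ := piLower_le_pi n
  have hπl := pi_sub_le_piLower n
  have hπ2 := two_le_piLower n
  have hπ0 := piLower_pos n
  have hn0 : 0 < n := by omega
  have hn' : (0 : ℝ) < n := by exact_mod_cast hn0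
  have h2n : (1 : ℝ) ≤ (2 : ℝ) ^ n := one_le_pow₀ (by norm_num)
  have h2n0 : (0 : ℝ) < (2 : ℝ) ^ n := by positivity
  have hρ1 : (2 : ℝ) ^ n * 2 ^ n ≤ ρ := by rw [← pow_add, ← two_mul]; exact hρ
  have hρ0 : (0 : ℝ) ≤ (ρ : ℝ) := le_trans (by positivity) hρ
  have hs0 : 0 ≤ Real.sqrt (π / n) := Real.sqrt_nonneg _
  -- `√(ρ²n/π₋)·√(π/n) = ρ√(π/π₋) ≤ ρ(1 + 2⁻ⁿ)`
  have hmain : Real.sqrt (widthSq ρ n : ℝ) * Real.sqrt (π / n) ≤ (ρ : ℝ) * (1 + 1 / (2 : ℝ) ^ n) := by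
    rw [← Real.sqrt_mul (by exact_mod_cast widthSq_nonneg ρ n)]
    have e : (widthSq ρ n : ℝ) * (π / n) = (ρ : ℝ) ^ 2 * (π / piLower n) := by
      unfold widthSq; push_cast; field_simp
    rw [e, Real.sqrt_mul (sq_nonneg _), Real.sqrt_sq hρ0]
    refine mul_le_mul_of_nonneg_left ?_ hρ0
    -- `√(π/π₋) ≤ π/π₋ ≤ 1 + 2⁻ⁿ`
    have hy : (1 : ℝ) ≤ π / piLower n := by rw [le_div_iff₀ hπ0]; linarith
    have hy' : π / (piLower n : ℝ) ≤ 1 + 1 / (2 : ℝ) ^ n := by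
      rw [div_le_iff₀ hπ0]
      have : π - (piLower n : ℝ) ≤ 1 / (2 : ℝ) ^ n := by linarith
      have h1 : 1 / (2 : ℝ) ^ n * 2 ≤ 1 / (2 : ℝ) ^ n * (piLower n : ℝ) :=
        mul_le_mul_of_nonneg_left hπ2 (by positivity)
      nlinarith
    calc Real.sqrt (π / piLower n) ≤ π / piLower n := by
          rw [Real.sqrt_le_left (by positivity)]
          nlinarith
      _ ≤ 1 + 1 / (2 : ℝ) ^ n := hy'
  -- `3√(π/n) ≤ 3√(π/16) < 2 ≤ ρ/2ⁿ`
  have hsmall : 3 * Real.sqrt (π / n) ≤ (ρ : ℝ) * (1 / (2 : ℝ) ^ n) := by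
    have h16 : (16 : ℝ) ≤ n := by exact_mod_cast hn
    have hs : Real.sqrt (π / n) ≤ 1 / 2 := by
      rw [Real.sqrt_le_left (by norm_num), div_le_iff₀ hn']
      nlinarith [Real.pi_lt_four]
    have h2 : (2 : ℝ) ≤ (2 : ℝ) ^ n := by
      calc (2 : ℝ) = 2 ^ 1 := by norm_num
        _ ≤ 2 ^ n := pow_le_pow_right₀ (by norm_num) (by omega)
    have : (2 : ℝ) ≤ (ρ : ℝ) * (1 / (2 : ℝ) ^ n) := by
      rw [mul_one_div, le_div_iff₀ h2n0]
      nlinarith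
    linarith
  calc ((bootA ρ n : ℕ) : ℝ) * Real.sqrt (π / n)
      ≤ (Real.sqrt (widthSq ρ n : ℝ) + 3) * Real.sqrt (π / n) := mul_le_mul_of_nonneg_right hA hs0
    _ = Real.sqrt (widthSq ρ n : ℝ) * Real.sqrt (π / n) + 3 * Real.sqrt (π / n) := by ring
    _ ≤ (ρ : ℝ) * (1 + 1 / (2 : ℝ) ^ n) + (ρ : ℝ) * (1 / (2 : ℝ) ^ n) := add_le_add hmain hsmall
    _ = (ρ : ℝ) * (1 + 2 / (2 : ℝ) ^ n) := by ring

/-- **The width slack in total variation**: `n·(1 − ρ/(A√(π/n))) ≤ 2n·2⁻ⁿ` for `ρ ≥ 2^{2n}`, `n ≥ 16`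
(the factor of `Regev2009.tvDist_discreteGaussian_le_mul_one_sub_div`). [cite: Regev2009, Lemma 3.2 (proof), Claim 2.1] -/
theorem width_slack_le {ρ : ℚ} {n : ℕ} (hn : 16 ≤ n) (hρ : (2 : ℝ) ^ (2 * n) ≤ ρ) :
    (n : ℝ) * (1 - (ρ : ℝ) / ((bootA ρ n : ℕ) * Real.sqrt (π / n))) ≤ 2 * n / (2 : ℝ) ^ n := by
  have hn0 : 0 < n := by omega
  have hρ0 : (0 : ℝ) ≤ (ρ : ℝ) := le_trans (by positivity) hρ
  have hρ0' : (0 : ℚ) ≤ ρ := by exact_mod_cast hρ0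
  have hlo := rho_le_bootWidth hρ0' hn0
  have hhi := bootWidth_le hn hρ
  have h2n0 : (0 : ℝ) < (2 : ℝ) ^ n := by positivity
  have hρpos : (0 : ℝ) < (ρ : ℝ) := lt_of_lt_of_le (by positivity) hρ
  set S : ℝ := (bootA ρ n : ℕ) * Real.sqrt (π / n) with hS
  have hS0 : 0 < S := lt_of_lt_of_le hρpos hlo
  have hfrac : 1 - (ρ : ℝ) / S ≤ 2 / (2 : ℝ) ^ n := by
    rw [sub_le_iff_le_add, ← sub_le_iff_le_add', le_div_iff₀ hS0]
    have : S * (2 / (2 : ℝ) ^ n) ≤ (ρ : ℝ) * (1 + 2 / (2 : ℝ) ^ n) * (2 / (2 : ℝ) ^ n) :=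
      mul_le_mul_of_nonneg_right hhi (by positivity)
    nlinarith [mul_nonneg (show (0 : ℝ) ≤ 2 / (2 : ℝ) ^ n by positivity) (sub_nonneg.2 hlo)]
  have hn' : (0 : ℝ) ≤ n := Nat.cast_nonneg _
  calc (n : ℝ) * (1 - (ρ : ℝ) / S) ≤ n * (2 / (2 : ℝ) ^ n) := mul_le_mul_of_nonneg_left hfrac hn'
    _ = 2 * n / (2 : ℝ) ^ n := by ring

/-! ### A size bound on `A` (for the unary window parameter of the machine) -/

/-- **`A ≤ |num ρ|·n + 3`** (crude: `√(ρ²n/π₋ₙ) ≤ |ρ|·n`). [cite: Regev2009, Lemma 3.2 (proof)] -/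
theorem bootA_le (ρ : ℚ) (n : ℕ) : bootA ρ n ≤ ρ.num.natAbs * n + 3 := by
  have hA := bootA_le_sqrt_widthSq_add_three ρ n
  have hπ2 := two_le_piLower n
  have hπ0 := piLower_pos n
  have hq0 : (0 : ℝ) ≤ (widthSq ρ n : ℝ) := by exact_mod_cast widthSq_nonneg ρ n
  have hn0 : (0 : ℝ) ≤ n := Nat.cast_nonneg _
  -- `|ρ| ≤ |num ρ|`
  have hρ : |(ρ : ℝ)| ≤ (ρ.num.natAbs : ℝ) := by
    have h1 : |(ρ : ℝ)| = |(ρ.num : ℝ)| / (ρ.den : ℝ) := by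
      conv_lhs => rw [← Rat.num_div_den ρ]
      push_cast
      rw [abs_div, abs_of_pos (show (0 : ℝ) < ρ.den by exact_mod_cast ρ.den_pos)]
    have h2 : (ρ.num.natAbs : ℝ) = |(ρ.num : ℝ)| := by rw [Nat.cast_natAbs, Int.cast_abs]
    rw [h1, div_le_iff₀ (by exact_mod_cast ρ.den_pos), h2]
    have hd : (1 : ℝ) ≤ ρ.den := by exact_mod_cast ρ.den_pos
    nlinarith [abs_nonneg (ρ.num : ℝ)]
  -- `q ≤ (|ρ| n)²`
  have hq : (widthSq ρ n : ℝ) ≤ (|(ρ : ℝ)| * n) ^ 2 := by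
    unfold widthSq; push_cast
    rw [div_le_iff₀ hπ0, mul_pow, sq_abs]
    rcases Nat.eq_zero_or_pos n with h0 | hpos
    · subst h0; simp
    · have hn1 : (1 : ℝ) ≤ n := by exact_mod_cast hpos
      have : (n : ℝ) ≤ (n : ℝ) ^ 2 * (piLower n : ℝ) := by nlinarith
      nlinarith [sq_nonneg (ρ : ℝ)]
  have hsq : Real.sqrt (widthSq ρ n : ℝ) ≤ |(ρ : ℝ)| * n := by
    rw [Real.sqrt_le_left (by positivity)]; exact hq
  have h : ((bootA ρ n : ℕ) : ℝ) ≤ ((ρ.num.natAbs * n + 3 : ℕ) : ℝ) := by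
    push_cast
    nlinarith [mul_le_mul_of_nonneg_right hρ hn0]
  exact_mod_cast h

/-- **The window parameter is short**: `wA A = ⌊log₂ A⌋ + 2 ≤ size(|num ρ|) + n + 3`.
[cite: GentryPeikertVaikuntanathan2008, §4.1] -/
theorem wA_bootA_le (ρ : ℚ) (n : ℕ) : wA (bootA ρ n) ≤ Nat.size ρ.num.natAbs + n + 3 := by
  have hA := bootA_le ρ n
  have hN : ρ.num.natAbs < 2 ^ Nat.size ρ.num.natAbs := Nat.lt_size_self _
  have hn : n < 2 ^ n := Nat.lt_two_pow_self
  have hlt : bootA ρ n < 2 ^ (Nat.size ρ.num.natAbs + n + 2) := by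
    have h1 : ρ.num.natAbs * n < 2 ^ Nat.size ρ.num.natAbs * 2 ^ n :=
      calc ρ.num.natAbs * n ≤ ρ.num.natAbs * 2 ^ n := Nat.mul_le_mul_left _ hn.le
        _ < 2 ^ Nat.size ρ.num.natAbs * 2 ^ n := mul_lt_mul_of_pos_right hN (Nat.two_pow_pos n)
    have h2 : 1 ≤ 2 ^ Nat.size ρ.num.natAbs * 2 ^ n := Nat.one_le_iff_ne_zero.2 (by positivity)
    calc bootA ρ n ≤ ρ.num.natAbs * n + 3 := hA
      _ < 2 ^ Nat.size ρ.num.natAbs * 2 ^ n * 4 := by omega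
      _ = 2 ^ (Nat.size ρ.num.natAbs + n + 2) := by rw [pow_add, pow_add]; norm_num
  have hlog : Nat.log 2 (bootA ρ n) < Nat.size ρ.num.natAbs + n + 2 :=
    Nat.log_lt_of_lt_pow (bootA_pos ρ n).ne' hlt
  unfold wA; omega

end Regev2009

end Literature.Computability.Cryptography
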